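import Mathlib
import Literature.MathematicalPhysics.QuantumFieldTheory.Balaban1983to89.B9SectECov

/-!
# `Balaban1983to89.B14.Eq126CondGaussian` — [Balaban1988Convergent] (1.26) p. 253: the conditional Gaussian integration
# over the fluctuation field on `Λ₁` defining `𝐕^{(0)}` and `𝐄^{(1)}` — the display TYPED over a finite-dimensional block
# model and its two equalities PROVED (normalization `Z^{(0)}(Λ₁) dμ_{C^{(0)}(Λ₁)}`; the completed square
# `½⟨Λ₁ᶜA, C*Δ₁C C^{(0)}(Λ₁) C*Δ₁C Λ₁ᶜA⟩`), with the Gaussian-source identity making `𝐄^{(1)} = 0` in the free case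

statement-level skeleton of published theorems with citation tags; proofs where landed; nothing here is a
claim about the Yang–Mills mass gap

PDF held: `paper:balaban1988-cmp119-convergent-renormalization` (journal page = PDF page + 242); (1.26) read on the x2 render
`…-p011-x2.png` (p. 253) of `run/shared/lean/pub/pub-balaban/b2b-balaban-ref1/pages/1988-cmp119-convergent-renormalization/`.

CITATION HEADER (lean-in-tree rule).  Source: T. Bałaban, *Convergent renormalization expansions for lattice gauge
theories*, Commun. Math. Phys. **119**, 243–285 (1988), doi:10.1007/bf01217741 [Balaban1988Convergent] (cell paper B14 =
"[III]").  Mega-formalization `lit-balaban` (HOME `run/shared/lean/pub/lit-balaban/`), reader/typer unit `lit-balaban-r11`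
(generation 3), SKELETON row **B14.Eq1.26** (status so far: "typed-existing (covariance aspect) · the completing-the-square
identity itself: absent here").

THE PRINTED TEXT (verbatim, p. 253 [PDF 11]).  *"background field. It is given by
  ∫ dA|_{Λ₁} χ^{(0)}(Λ₁) exp[ −½⟨Λ₁A, C*Δ₁CΛ₁A⟩ − ⟨Λ₁ᶜA, C*Δ₁CΛ₁A⟩ + v(g₀CA) − (1/g₀²) V(g₀CA) ]
   = Z^{(0)}(Λ₁) ∫ dμ_{C^{(0)}(Λ₁)}(A) χ^{(0)}(Λ₁) exp[ −⟨Λ₁ᶜA, C*Δ₁CΛ₁A⟩ + 𝐕^{(0)}(g₀, A) ]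
   = exp[ log Z^{(0)}(Λ₁) + ½⟨Λ₁ᶜA, C*Δ₁CC^{(0)}(Λ₁)C*Δ₁CΛ₁ᶜA⟩ + 𝐄^{(1)}(Λ₁, g₀, Λ₁ᶜA) ] .   (1.26)
The above equalities define the functions 𝐕^{(0)} and 𝐄^{(1)}."*

THE MODEL (finite-dimensional blocks, as in the tree's Gaussian files `…Beta.GaussianIntegral`, `…B9SectECov`,
`…B14GaussianDet333`).  The fluctuation variables `Λ₁A` integrated over are `x : ι → ℝ` (Lebesgue measure `volume`), the
external variables `Λ₁ᶜA` are `y : κ → ℝ`; of the positive operator `T = C*Δ₁C` only two blocks enter: the `Λ₁Λ₁`-block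
`M : Matrix ι ι ℝ` (positive definite, `⟨Λ₁A, C*Δ₁CΛ₁A⟩ = xᵀMx`) and the `Λ₁ᶜΛ₁`-block `K : Matrix κ ι ℝ`
(`⟨Λ₁ᶜA, C*Δ₁CΛ₁A⟩ = yᵀKx`); `C^{(0)}(Λ₁) = M⁻¹` (the covariance of the conditional Gaussian measure), so that the printed
`⟨Λ₁ᶜA, C*Δ₁C C^{(0)}(Λ₁) C*Δ₁C Λ₁ᶜA⟩` is `yᵀ K M⁻¹ Kᵀ y` (`T` symmetric: the `Λ₁Λ₁ᶜ`-block is `Kᵀ`).  The characteristic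
function `χ^{(0)}(Λ₁)` and the interaction `𝐕^{(0)}(g₀, A) := v(g₀CA) − g₀⁻²V(g₀CA)` are abstract functions of `(x, y)`.

WHAT IS TYPED (definitions with bodies): `Z0 M` = `Z^{(0)}(Λ₁) = ∫ dx e^{−½xᵀMx}`; `gaussExpect M F` = `∫ dμ_{C^{(0)}(Λ₁)} F`
(the normalized centred Gaussian measure with covariance `M⁻¹`, written as `Z⁻¹ ∫ F e^{−½xᵀMx} dx`); `V0 v V g₀` = **𝐕^{(0)}**;
`lhs126` = the left member of (1.26); `mid126` = the integral of the middle member; `E1` = **𝐄^{(1)}(Λ₁, g₀, Λ₁ᶜA)** as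
DEFINED by the last equality (`log` of the normalized integral minus the completed square).
WHAT IS PROVED: `Z0_pos`; **`eq126_first`** (the first equality: `lhs126 = Z^{(0)}(Λ₁) · mid126`); **`eq126_second`** (the
second equality, for a positive middle integral); `gaussExpect_exp_neg_source` (the Gaussian-source identity behind the
completed square: `∫ dμ_{M⁻¹} e^{−yᵀKx} = e^{½ yᵀKM⁻¹Kᵀy}`, from the tree's `B9SectECov.genFun_eq`); **`E1_free`** (free
case `χ^{(0)} = 1`, `𝐕^{(0)} = 0` ⇒ `𝐄^{(1)} = 0`: the subtraction in (1.26) is exactly the Gaussian contribution of the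
linear cross term).
NOT HERE: the operators `C`, `Δ₁`, `C^{(0)}(Λ₁)` of B10/B12, `χ^{(0)}`, `v`, `V` ((1.15)–(1.16)), the cluster expansion
of `𝐄^{(1)}` and the boundary term `𝐁^{(1)}` (p. 253).  No `sorry`.
-/

noncomputable section

open _root_.MeasureTheory Matrix Real
open scoped Matrix

namespace Literature.MathematicalPhysics.QuantumFieldTheory.Balaban1983to89.B14.Eq126CondGaussian

open Literature.MathematicalPhysics.QuantumFieldTheory.Balaban1983to89.Beta (GaussianIntegral.integral_exp_neg_half_quadForm)

variable {ι : Type*} [Fintype ι] [DecidableEq ι] {κ : Type*} [Fintype κ]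

/-! ## §1. The conditional Gaussian measure `Z^{(0)}(Λ₁) dμ_{C^{(0)}(Λ₁)}` -/

/-- `Z^{(0)}(Λ₁) = ∫ dA|_{Λ₁} exp[−½⟨Λ₁A, C*Δ₁CΛ₁A⟩]` — the normalization of the conditional Gaussian measure
(`M` = the `Λ₁Λ₁`-block of `C*Δ₁C`). [cite: Balaban1988Convergent, (1.26) p.253] -/
def Z0 (M : Matrix ι ι ℝ) : ℝ := ∫ x : ι → ℝ, Real.exp (-(1/2 : ℝ) * (x ⬝ᵥ M *ᵥ x))

/-- `∫ dμ_{C^{(0)}(Λ₁)}(A) F(Λ₁A)`: the expectation in the normalized centred Gaussian measure with covariance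
`C^{(0)}(Λ₁) = M⁻¹`, i.e. `Z^{(0)}(Λ₁)⁻¹ ∫ dx F(x) e^{−½xᵀMx}`. [cite: Balaban1988Convergent, (1.26) p.253] -/
def gaussExpect (M : Matrix ι ι ℝ) (F : (ι → ℝ) → ℝ) : ℝ :=
  (Z0 M)⁻¹ * ∫ x : ι → ℝ, F x * Real.exp (-(1/2 : ℝ) * (x ⬝ᵥ M *ᵥ x))

/-- `Z^{(0)}(Λ₁) = √(2π)^{|Λ₁|}/√det M > 0` (tree: `Beta.GaussianIntegral.integral_exp_neg_half_quadForm`).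
[cite: Balaban1988Convergent, (1.26) p.253] -/
theorem Z0_pos {M : Matrix ι ι ℝ} (hM : M.PosDef) : 0 < Z0 M := by
  unfold Z0
  rw [GaussianIntegral.integral_exp_neg_half_quadForm M hM]
  exact B9SectECov.gaussNorm_pos hM

/-! ## §2. The three members of (1.26) -/

/-- **𝐕^{(0)}(g₀, A) := v(g₀CA) − (1/g₀²)V(g₀CA)** (first equality of (1.26); `v`, `V` the cubic-and-higher parts (1.15)–(1.16)
as abstract functions of the scaled field, here of `(x, y) = (Λ₁A, Λ₁ᶜA)`). [cite: Balaban1988Convergent, (1.26) p.253] -/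
def V0 (v V : (ι → ℝ) → (κ → ℝ) → ℝ) (g₀ : ℝ) (x : ι → ℝ) (y : κ → ℝ) : ℝ :=
  v x y - (1 / g₀ ^ 2) * V x y

/-- The left member of (1.26): `∫ dA|_{Λ₁} χ^{(0)}(Λ₁) exp[−½xᵀMx − yᵀKx + v − g₀⁻²V]`.
[cite: Balaban1988Convergent, (1.26) p.253] -/
def lhs126 (M : Matrix ι ι ℝ) (K : Matrix κ ι ℝ) (χ : (ι → ℝ) → ℝ) (v V : (ι → ℝ) → (κ → ℝ) → ℝ) (g₀ : ℝ)
    (y : κ → ℝ) : ℝ :=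
  ∫ x : ι → ℝ, χ x * Real.exp (-(1/2 : ℝ) * (x ⬝ᵥ M *ᵥ x) - y ⬝ᵥ K *ᵥ x + (v x y - (1 / g₀ ^ 2) * V x y))

/-- The normalized integral of the middle member of (1.26): `∫ dμ_{C^{(0)}(Λ₁)} χ^{(0)}(Λ₁) exp[−yᵀKx + 𝐕^{(0)}(g₀, A)]`.
[cite: Balaban1988Convergent, (1.26) p.253] -/
def mid126 (M : Matrix ι ι ℝ) (K : Matrix κ ι ℝ) (χ : (ι → ℝ) → ℝ) (v V : (ι → ℝ) → (κ → ℝ) → ℝ) (g₀ : ℝ)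
    (y : κ → ℝ) : ℝ :=
  gaussExpect M fun x => χ x * Real.exp (-(y ⬝ᵥ K *ᵥ x) + V0 v V g₀ x y)

/-- **𝐄^{(1)}(Λ₁, g₀, Λ₁ᶜA)** as DEFINED by the last equality of (1.26):
`𝐄^{(1)} := log ∫ dμ_{C^{(0)}(Λ₁)} χ^{(0)} exp[−⟨Λ₁ᶜA, C*Δ₁CΛ₁A⟩ + 𝐕^{(0)}] − ½⟨Λ₁ᶜA, C*Δ₁C C^{(0)}(Λ₁) C*Δ₁C Λ₁ᶜA⟩`, the completed
square being `½ yᵀ K M⁻¹ Kᵀ y`. [cite: Balaban1988Convergent, (1.26) p.253] -/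
def E1 (M : Matrix ι ι ℝ) (K : Matrix κ ι ℝ) (χ : (ι → ℝ) → ℝ) (v V : (ι → ℝ) → (κ → ℝ) → ℝ) (g₀ : ℝ)
    (y : κ → ℝ) : ℝ :=
  Real.log (mid126 M K χ v V g₀ y) - (1/2 : ℝ) * (y ⬝ᵥ (K * M⁻¹ * Kᵀ) *ᵥ y)

/-- **(1.26), first equality**: `∫ dA|_{Λ₁} χ^{(0)} exp[−½⟨Λ₁A,TΛ₁A⟩ − ⟨Λ₁ᶜA,TΛ₁A⟩ + v − g₀⁻²V]
= Z^{(0)}(Λ₁) ∫ dμ_{C^{(0)}(Λ₁)} χ^{(0)} exp[−⟨Λ₁ᶜA,TΛ₁A⟩ + 𝐕^{(0)}]` — the Gaussian density split off and normalized.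
[cite: Balaban1988Convergent, (1.26) p.253] -/
theorem eq126_first {M : Matrix ι ι ℝ} (hM : M.PosDef) (K : Matrix κ ι ℝ) (χ : (ι → ℝ) → ℝ)
    (v V : (ι → ℝ) → (κ → ℝ) → ℝ) (g₀ : ℝ) (y : κ → ℝ) :
    lhs126 M K χ v V g₀ y = Z0 M * mid126 M K χ v V g₀ y := by
  unfold lhs126 mid126 gaussExpect V0
  rw [← mul_assoc, mul_inv_cancel₀ (Z0_pos hM).ne', one_mul]
  refine integral_congr_ae (ae_of_all _ fun x => ?_)
  dsimp only
  rw [mul_assoc, ← Real.exp_add]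
  congr 2
  ring

/-- **(1.26), second equality**: when the middle integral is positive (χ^{(0)} ≥ 0 and not negligible),
`Z^{(0)}(Λ₁) ∫ dμ χ^{(0)} exp[…] = exp[log Z^{(0)}(Λ₁) + ½⟨Λ₁ᶜA, C*Δ₁C C^{(0)}(Λ₁) C*Δ₁C Λ₁ᶜA⟩ + 𝐄^{(1)}(Λ₁, g₀, Λ₁ᶜA)]` — by the
definition of `𝐄^{(1)}`. [cite: Balaban1988Convergent, (1.26) p.253] -/
theorem eq126_second {M : Matrix ι ι ℝ} (hM : M.PosDef) (K : Matrix κ ι ℝ) (χ : (ι → ℝ) → ℝ)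
    (v V : (ι → ℝ) → (κ → ℝ) → ℝ) (g₀ : ℝ) (y : κ → ℝ) (hpos : 0 < mid126 M K χ v V g₀ y) :
    Z0 M * mid126 M K χ v V g₀ y
      = Real.exp (Real.log (Z0 M) + (1/2 : ℝ) * (y ⬝ᵥ (K * M⁻¹ * Kᵀ) *ᵥ y) + E1 M K χ v V g₀ y) := by
  unfold E1
  rw [show Real.log (Z0 M) + (1/2 : ℝ) * (y ⬝ᵥ (K * M⁻¹ * Kᵀ) *ᵥ y)
      + (Real.log (mid126 M K χ v V g₀ y) - (1/2 : ℝ) * (y ⬝ᵥ (K * M⁻¹ * Kᵀ) *ᵥ y))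
      = Real.log (Z0 M) + Real.log (mid126 M K χ v V g₀ y) by ring,
    Real.exp_add, Real.exp_log (Z0_pos hM), Real.exp_log hpos]

/-- **(1.26), both equalities**. [cite: Balaban1988Convergent, (1.26) p.253] -/
theorem eq126 {M : Matrix ι ι ℝ} (hM : M.PosDef) (K : Matrix κ ι ℝ) (χ : (ι → ℝ) → ℝ)
    (v V : (ι → ℝ) → (κ → ℝ) → ℝ) (g₀ : ℝ) (y : κ → ℝ) (hpos : 0 < mid126 M K χ v V g₀ y) :
    lhs126 M K χ v V g₀ y
      = Real.exp (Real.log (Z0 M) + (1/2 : ℝ) * (y ⬝ᵥ (K * M⁻¹ * Kᵀ) *ᵥ y) + E1 M K χ v V g₀ y) := by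
  rw [eq126_first hM, eq126_second hM K χ v V g₀ y hpos]

/-! ## §3. Why the completed square: the Gaussian-source identity, and the free case `𝐄^{(1)} = 0` -/

/-- **The Gaussian-source identity behind the completed square of (1.26)**: `∫ dμ_{C^{(0)}(Λ₁)} e^{−yᵀKx} = e^{½ yᵀ K M⁻¹ Kᵀ y}`
(the tree's `B9SectECov.genFun_eq` with source `h = −Kᵀy`). [cite: Balaban1988Convergent, (1.26) p.253] -/
theorem gaussExpect_exp_neg_source {M : Matrix ι ι ℝ} (hM : M.PosDef) (K : Matrix κ ι ℝ) (y : κ → ℝ) :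
    gaussExpect M (fun x => Real.exp (-(y ⬝ᵥ K *ᵥ x)))
      = Real.exp ((1/2 : ℝ) * (y ⬝ᵥ (K * M⁻¹ * Kᵀ) *ᵥ y)) := by
  unfold gaussExpect Z0
  have hsrc : ∀ x : ι → ℝ, -(y ⬝ᵥ K *ᵥ x) = (-(Kᵀ *ᵥ y)) ⬝ᵥ x := by
    intro x
    rw [neg_dotProduct, dotProduct_mulVec, ← mulVec_transpose, dotProduct_comm]
  have h1 : (fun x : ι → ℝ => Real.exp (-(y ⬝ᵥ K *ᵥ x)) * Real.exp (-(1/2 : ℝ) * (x ⬝ᵥ M *ᵥ x)))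
      = fun x => Real.exp (-(1/2 : ℝ) * (x ⬝ᵥ M *ᵥ x) + (-(Kᵀ *ᵥ y)) ⬝ᵥ x) := by
    funext x
    rw [← Real.exp_add, hsrc x, add_comm]
  rw [h1, B9SectECov.genFun_eq M hM (-(Kᵀ *ᵥ y))]
  congr 2
  rw [mulVec_neg, neg_dotProduct, dotProduct_neg, neg_neg]
  conv_rhs => rw [← mulVec_mulVec, ← mulVec_mulVec, dotProduct_mulVec, ← mulVec_transpose]

/-- **Free case**: with `χ^{(0)} = 1` and `𝐕^{(0)} = 0` the definition (1.26) gives `𝐄^{(1)} = 0` — the subtracted term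
`½⟨Λ₁ᶜA, C*Δ₁C C^{(0)}(Λ₁) C*Δ₁C Λ₁ᶜA⟩` is exactly the Gaussian contribution of the cross term `−⟨Λ₁ᶜA, C*Δ₁CΛ₁A⟩`.
[cite: Balaban1988Convergent, (1.26) p.253] -/
theorem E1_free {M : Matrix ι ι ℝ} (hM : M.PosDef) (K : Matrix κ ι ℝ) (g₀ : ℝ) (y : κ → ℝ) :
    E1 M K (fun _ => 1) (fun _ _ => 0) (fun _ _ => 0) g₀ y = 0 := by
  unfold E1 mid126
  have h : gaussExpect M (fun x => (1 : ℝ) * Real.exp (-(y ⬝ᵥ K *ᵥ x) + V0 (fun _ _ => 0) (fun _ _ => 0) g₀ x y))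
      = gaussExpect M (fun x => Real.exp (-(y ⬝ᵥ K *ᵥ x))) := by
    simp [V0]
  rw [h, gaussExpect_exp_neg_source hM K y, Real.log_exp, sub_self]

end Literature.MathematicalPhysics.QuantumFieldTheory.Balaban1983to89.B14.Eq126CondGaussian
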